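import Summits.Schanuel.Schanuel.Theorems.ZilberEacGrowthDensity
import Summits.Schanuel.Schanuel.Theorems.ZilberEacFermatEscape
import Summits.Schanuel.Schanuel.Theorems.ZilberEacFermatSurface
import HarnessLib

/-!
# Mantova–Masser's example (fermat): the exponential points of `{x₀ᴺ + x₁ᴺ = 1, y₀ + y₁ = 1}` are Zariski dense

Zilber's Exponential-Algebraic Closedness, case ladder (host summit Schanuel, cell `pub-schanuel`,
seat 2, gen 5).  Mantova–Masser [MantovaMasser2023, §1 Further remarks, p. 5] write, about the
Zariski density of the UNPROJECTED exponential points: "In our situation the analogous statement is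
unclear, even for `n = 2` … Just for the example (fermat) [`X₁⁹ + X₂⁹ = 1`, `X̂₁ + X̂₂ = 1`] the
density in `S` would amount to the fact that there is no `G ≠ 0` in `ℂ[X₁, X̂₁]` such that
`G(z, e^z) = 0` for all `z` with `e^z + e^{(1 - z⁹)^{1/9}} = 1`, which does not seem obvious."

* `unprojectedDense_fermatSurface`: **for every `N ≥ 2` the exponential points of
  `S_N = {x₀ᴺ + x₁ᴺ = 1, y₀ + y₁ = 1} ⊆ ℂ² × ℂ²` are Zariski dense in `S_N`**, in the ideal-theoretic
  sense `I(S_N ∩ Γ_exp) = I(S_N)` (`UnprojectedDense`).  Proof: THEOREM G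
  (`unprojectedDense_of_growth`: exponential points of an irreducible surface escaping with
  `|Re x_j| / log‖x_j‖ → ∞` are Zariski generic — transcendence of `x_j` in the function field of any
  curve containing infinitely many of them, via the Pólya log-strip) applied to the escaping points of
  `ZilberEacFermatEscape` on the irreducible surface `S_N` (`ZilberEacFermatSurface`).
* `unprojectedDense_mantovaMasserFermat`: `N = 9`.
* `eval_eq_zero_of_fermat_expPoints`: the coordinate reading — a polynomial `G(x₀, x₁, y₀, y₁)`
  vanishing at every `(z, w, e^z, e^w)` with `zᴺ + wᴺ = 1`, `e^z + e^w = 1` vanishes on all of `S_N`.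
* The certificate that `S_N` is an instance of the repaired (free) density question
  (`MMCaseDimPiOneFree S_N ∧ IsMulFree (S_N ∩ G²)`) is `ZilberEacFermatCase`; the conjunction with the
  density is recorded in `ZilberEacFermatInstance`.

PRIOR TREE RESULT (seat 1, gen 8, `Literature…EACDensityQuestion`, Part D):
`mantovaMasser_fermat_noRelation` decided Mantova–Masser's literal sentence for `N = 9` — no
`G(X₁, X̂₁) ≠ 0` with `G(z, e^z) = 0` on all solutions — by the same escape (branch
`η z (1 - z⁻⁹)^{1/9}`, contraction) plus Liouville elimination in `ℂ[z][w]`; its docstring records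
that the equivalence of that sentence with density in the surface ("would amount to", a norm
argument over `ℂ(x₁)`) was NOT formalised.  The present file proves the density itself, for all
`N ≥ 2` and all `G ∈ ℂ[x₀, x₁, y₀, y₁]`, through THEOREM G instead of the norm argument.

HONEST FRAMING: one explicit instance (a non-graph base curve of genus `(N-1)(N-2)/2`) of a question
whose free form is OPEN; `EC(3,2)` OPEN; nothing here bears on Schanuel's conjecture (EAC ⇏ SC).
-/

noncomputable section

open MvPolynomial Complex Filter
open Literature.NumberTheory.Transcendental Literature.ModelTheory.Zilber

set_option linter.dupNamespace false

namespace Summit.Schanuel.Schanuel.Theorems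

/-- **Mantova–Masser's example (fermat), all exponents**: for `N ≥ 2` the exponential points of the
Fermat surface `{x₀ᴺ + x₁ᴺ = 1, y₀ + y₁ = 1} ⊆ ℂ² × ℂ²` are Zariski dense in it
(`I(S ∩ Γ_exp) = I(S)`). [cite: MantovaMasser2023, §1 Further remarks, p. 5 (example (fermat))] -/
theorem unprojectedDense_fermatSurface {N : ℕ} (hN : 2 ≤ N) :
    UnprojectedDense {s : Fin 2 ⊕ Fin 2 → ℂ | s (Sum.inl 0) ^ N + s (Sum.inl 1) ^ N = 1 ∧
      s (Sum.inr 0) + s (Sum.inr 1) = 1} := by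
  obtain ⟨p, hF, hL, hexp, hgr⟩ := exists_fermat_expPoints hN
  refine unprojectedDense_of_growth (isIrreducibleClosed_fermatSurface N (by omega))
    (zariskiDim_fermatSurface_le N (by omega)) 0 (p := p) (fun m => ⟨hF m, hL m⟩) (fun m => ?_) hgr
  rw [mem_expGraph_iff]
  intro i
  rw [Literature.ModelTheory.ExponentialFields.ExponentialRing.complex_exp_eq]
  exact hexp m i

/-- **Mantova–Masser's example (fermat) itself** (`N = 9`): the exponential points of
`{x₀⁹ + x₁⁹ = 1, y₀ + y₁ = 1}` are Zariski dense. [cite: MantovaMasser2023, §1 Further remarks, p. 5] -/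
theorem unprojectedDense_mantovaMasserFermat :
    UnprojectedDense {s : Fin 2 ⊕ Fin 2 → ℂ | s (Sum.inl 0) ^ 9 + s (Sum.inl 1) ^ 9 = 1 ∧
      s (Sum.inr 0) + s (Sum.inr 1) = 1} :=
  unprojectedDense_fermatSurface (by norm_num)

/-- **Coordinate reading**: a polynomial `G ∈ ℂ[x₀, x₁, y₀, y₁]` with `G(z, w, e^z, e^w) = 0` for all
`z, w` with `zᴺ + wᴺ = 1` and `e^z + e^w = 1` vanishes identically on the Fermat surface
`{x₀ᴺ + x₁ᴺ = 1, y₀ + y₁ = 1}` (`N ≥ 2`). [cite: MantovaMasser2023, §1 Further remarks, p. 5] -/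
theorem eval_eq_zero_of_fermat_expPoints {N : ℕ} (hN : 2 ≤ N) (G : MvPolynomial (Fin 2 ⊕ Fin 2) ℂ)
    (hG : ∀ z w : ℂ, z ^ N + w ^ N = 1 → exp z + exp w = 1 →
      aeval (Sum.elim ![z, w] ![exp z, exp w]) G = 0)
    {s : Fin 2 ⊕ Fin 2 → ℂ} (hs1 : s (Sum.inl 0) ^ N + s (Sum.inl 1) ^ N = 1)
    (hs2 : s (Sum.inr 0) + s (Sum.inr 1) = 1) : aeval s G = 0 := by
  have hd := unprojectedDense_fermatSurface hN
  have hGI : G ∈ vanishingIdeal ℂ ({s : Fin 2 ⊕ Fin 2 → ℂ | s (Sum.inl 0) ^ N + s (Sum.inl 1) ^ N = 1 ∧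
      s (Sum.inr 0) + s (Sum.inr 1) = 1} ∩ expGraph ℂ 2) := by
    rw [mem_vanishingIdeal_iff]
    rintro t ⟨⟨ht1, ht2⟩, htΓ⟩
    rw [mem_expGraph_iff] at htΓ
    have h0 := htΓ 0
    have h1 := htΓ 1
    rw [Literature.ModelTheory.ExponentialFields.ExponentialRing.complex_exp_eq] at h0 h1
    have ht : t = Sum.elim ![t (Sum.inl 0), t (Sum.inl 1)] ![exp (t (Sum.inl 0)), exp (t (Sum.inl 1))] := by
      funext v
      rcases v with j | j <;> fin_cases j
      · rfl
      · rfl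
      · exact h0
      · exact h1
    rw [ht]
    refine hG _ _ ht1 ?_
    rw [← h0, ← h1]; exact ht2
  rw [UnprojectedDense] at hd
  rw [hd, mem_vanishingIdeal_iff] at hGI
  exact hGI s ⟨hs1, hs2⟩

end Summit.Schanuel.Schanuel.Theorems
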